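import Summits.QuantumAdvantage.QuantumAdvantage.Theses.CubicForrelation
import Summits.QuantumAdvantage.QuantumAdvantage.Theorems.NearExactIsExact.Negative.CentroidMoments
import Summits.QuantumAdvantage.QuantumAdvantage.Theorems.CubicForrelationNearExactIsExactMmWalsh
import Literature.Computability.QuantumComplexity.ForrelationDerivativeTables
import HarnessLib

/-!
# No Maiorana–McFarland cubic over a quadratic map is "case A" at `n = 14` (NearExactIsExact, disprover's structure file)

Negative-side STRUCTURE for the crux `CubicForrelation.NearExactIsExact` (item `near_exact_is_exact`,
stmt-QuantumAdvantage-14043) at `n = 14`, from the B2b disprover seat (gen 16). HONEST FRAMING: a THEOREM about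
Boolean functions on the finite slice `n = 14 = 5 + 9`, NOT summit progress; it closes one more habitat in which a
cubic pair with `Φ ∈ (15/16, 31/32]` (the open `n = 14` window) could have lived.

**Setting.** The landed second-boundary analysis at `n = 14` (`…FourteenSecondStructureB`, `fo_second_structure_sharp`,
`NoConstantResidueFourteen`, `NoCaseATwelve`) leaves "case A": a cubic `g` on `14` bits whose Walsh spectrum is
`W_g = 32·u` with EVERY `u ≡ ±3 (mod 8)` (equivalently the exceptional set `E` of the digit tables is empty; such a
`g` would be the `g`-half of a pair with `Φ = 31/32`). Gen 4–7 closed the Maiorana–McFarland class `MM(7,7)`;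
gen 15 proposed the wider habitat `MM(5,9)`: `g(x,y) = x·φ(y) ⊕ h(y)`, `x ∈ 𝔽₂⁵`, `y ∈ 𝔽₂⁹`, `φ = (q₀,…,q₄)`
quadratic (so that `g` is cubic), `h` an arbitrary cubic — equivalently, `g` affine on every coset of a fixed
`5`-dimensional subspace. By Carlet's Prop. 53, `W_g(a ‖ b) = 2⁵ f_a(b)` with the signed fibre sums
`f_a(b) = Σ_{φ(y)=a} (-1)^{h(y)} (-1)^{b·y}` (`W_signForm`), so case A says: all `f_a(b) ≡ ±3 (mod 8)`.

**THEOREM MM59 (`no_residuePM3`, `no_caseA_signForm`, `no_caseA_signForm_digits`).** For NO quadratic map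
`φ : 𝔽₂⁹ → 𝔽₂⁵` and NO odd weights `ε : 𝔽₂⁹ → 2ℤ+1` (in particular `ε = (-1)^h`, `h` of ANY degree) are the
`2⁵ · 2⁹` signed fibre sums `f_a(b) = Σ_{φ(y)=a} ε_y (-1)^{b·y}` all `≡ ±3 (mod 8)`. Hence no `g ∈ MM(5,9)`
(`⊋ MM(7,7)` for the window question) is case A at `n = 14`.

## The argument (centroids; elementary, fully formalised below)

Fix `a`, `A = φ⁻¹(a)`, `S = Σ_{y∈A} ε_y = f_a(0)` (odd), and the CENTROID `c = c(A) := Σ_{y ∈ A} y ∈ 𝔽₂⁹`.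
* (S1, `charSum_sub_dvd_four`) `f_a(b) ≡ S·(-1)^{b·c} (mod 4)` for every `b` — because `(-1)^k ≡ 1 - 2k (mod 4)`
  and `ε ≡ 1 (mod 2)`: both sides are `≡ S - 2 Σ_j b_j N_j (mod 4)`, `N_j = #{y ∈ A : y_j = 1}`.
* (S2, `fs_sub_dvd_eight`) With all residues in `{±3}` this pins them: `f_a(b) ≡ 3σ_a (-1)^{b·c} (mod 8)`.
* (S3, `second_moment`, `momCond_fib`) Reading S2 at `b ∈ {0, e_j, e_k, e_j ⊕ e_k}`:
  `4·#^ε{y ∈ A : y_j = y_k = 1} = f(0) - f(e_j) - f(e_k) + f(e_j⊕e_k) ≡ 12 σ_a c_j c_k (mod 8)`, so `A` satisfies the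
  MOMENT CONDITION `#{y ∈ A : y ⊇ T} ≡ [c ⊇ T] (mod 2)` for all `|T| ≤ 2`; expanding a quadratic `r` into monomials
  (`natCast_card_filter_quadratic`) gives `#{y ∈ A : r(y)=1} ≡ r(c) (mod 2)` for EVERY quadratic `r`.
* (S4, `cen_mem_fib`) Apply this to `r = q_i` (constant `a_i` on `A`, `#A` odd): `q_i(c) = a_i`, i.e. `φ(c(A_a)) = a` —
  every fibre contains its own centroid; in particular the `32` centroids are pairwise distinct.
* (S5, `glue_even`) For the `2`-flat `P = {a : a₂ = a₃ = a₄ = 0}` and a quadratic `r`, the function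
  `y ↦ [φ(y) ∈ P]·r(y) = (1⊕q₂)(1⊕q₃)(1⊕q₄)·r` has degree `≤ 8 < 9`, hence EVEN weight
  (`natCast_card_eq_zero_of_isDegLeFun`, flip a free variable); its weight is `Σ_{a∈P} #{y ∈ A_a : r(y)=1}
  ≡ Σ_{a ∈ P} r(c(A_a)) (mod 2)`. So the four distinct points `c(A_a)`, `a ∈ P`, have all coordinate sums
  (`r = y_j`) and all pair-product sums (`r = y_j y_k`) even.
* (S6, `four_points`) No four distinct points of `𝔽₂^m` do: with `s = p₀⊕p₁ ≠ 0`, `t = p₀⊕p₂ ≠ 0`, `s ≠ t` and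
  `p₃ = p₀⊕s⊕t`, the pair condition reads `s_j t_k = s_k t_j` (`j ≠ k`), forcing `t = 0` or `s = t`. ∎

What remains of case A at `n = 14` after this file: `g` NOT affine on the cosets of any `5`-space (for the record:
the reduction "rank-2 case A at 14 ⇒ case A at 12" of gen 16's notes is killed by `NoCaseATwelve.no_caseA`, and
rank 0 by `NoConstantResidueFourteen`; the general rank-2 case is open). Numerical cross-checks (seat folder
`code/disprove-g16/fib/`): exhaustive classification of admissible signed fibres in `𝔽₂⁵` (223217856 sets, none of
size `< 13`), random tests of S1 (0 failures), and the closed size-15 configurations that motivated S5–S6.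

Sources (orientation; everything here is proved from scratch): C. Carlet, Boolean Functions for Cryptography and
Coding Theory (CUP 2020), §5.1 Prop. 53 (Walsh transform of the Maiorana–McFarland class); R. L. McFarland, JCTA 15
(1973); J. F. Dillon, PhD thesis (1974) Ch. 5; R. O'Donnell, Analysis of Boolean Functions (2014) §1.4.
Axioms: `propext`, `Classical.choice`, `Quot.sound` only.
-/

set_option linter.dupNamespace false -- D-0017: single-problem summit ⇒ `QuantumAdvantage.QuantumAdvantage` by design

namespace Summit.QuantumAdvantage.QuantumAdvantage.Theorems.NearExactIsExact.Negative.MM59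

open Finset
open Literature.Computability.QuantumComplexity
open Summit.QuantumAdvantage.QuantumAdvantage.Theorems.NearExactIsExact.Negative.CentroidMoments

/-! ### Quadratic fibrations `φ = (q₀,…,q₄) : 𝔽₂⁹ → 𝔽₂⁵` and their signed fibre sums -/

section Fibration

variable (q : Fin 5 → (Fin 9 → Bool) → Bool) (ε : (Fin 9 → Bool) → ℤ)

/-- The fibre `A_a = φ⁻¹(a)` of `φ = (q₀,…,q₄)`. [folklore] -/
def fib (a : Fin 5 → Bool) : Finset (Fin 9 → Bool) := {y | ∀ i, q i y = a i}

/-- The signed character sum of a fibre, `f_a(b) = Σ_{y ∈ A_a} ε_y (-1)^{b·y}`. [folklore] -/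
def fs (a : Fin 5 → Bool) (b : Fin 9 → Bool) : ℤ := ∑ y ∈ fib q a, ε y * zt b y

/-- The sign `σ_a ∈ {±1}` with `f_a(0) ≡ 3σ_a (mod 8)`. [folklore] -/
def sgn (a : Fin 5 → Bool) : ℤ := if fs q ε a (fun _ => false) % 8 = 3 then 1 else -1

variable {q ε}

/-- Membership in a fibre. [folklore] -/
theorem mem_fib {a : Fin 5 → Bool} {y : Fin 9 → Bool} : y ∈ fib q a ↔ ∀ i, q i y = a i := by
  simp [fib]

/-- `f_a(0) = Σ_{y ∈ A_a} ε_y`. [folklore] -/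
theorem fs_zero (a : Fin 5 → Bool) : fs q ε a (fun _ => false) = ∑ y ∈ fib q a, ε y := by
  unfold fs
  exact Finset.sum_congr rfl fun y _ => by rw [zt_zero, mul_one]

/-- The fibre totals `f_a(0)` are odd. [folklore] -/
theorem odd_total (hA : ∀ a b, fs q ε a b % 8 = 3 ∨ fs q ε a b % 8 = 5) (a : Fin 5 → Bool) :
    Odd (∑ y ∈ fib q a, ε y) := by
  rw [← fs_zero, Int.odd_iff]
  have := hA a (fun _ => false)
  omega

/-- `#A_a` is odd. [folklore] -/
theorem natCast_card_fib (hε : ∀ y, Odd (ε y)) (hA : ∀ a b, fs q ε a b % 8 = 3 ∨ fs q ε a b % 8 = 5)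
    (a : Fin 5 → Bool) :
    ((#(fib q a) : ℕ) : ZMod 2) = 1 := by
  rw [← intCast_sum_odd (fib q a) ε hε, (odd_total hA a).intCast_zmod_two]

/-- **(S2) All residues are explained by the centroid**: `f_a(b) ≡ 3 σ_a (-1)^{b·c(A_a)} (mod 8)`. [folklore] -/
theorem fs_sub_dvd_eight (hε : ∀ y, Odd (ε y)) (hA : ∀ a b, fs q ε a b % 8 = 3 ∨ fs q ε a b % 8 = 5)
    (a : Fin 5 → Bool) (b : Fin 9 → Bool) : (8 : ℤ) ∣ fs q ε a b - 3 * sgn q ε a * zt b (cen (fib q a)) := by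
  have h0 := hA a (fun _ => false)
  have hb := hA a b
  have h4 : (4 : ℤ) ∣ fs q ε a b - fs q ε a (fun _ => false) * zt b (cen (fib q a)) := by
    rw [fs_zero]
    exact charSum_sub_dvd_four (fib q a) ε hε (odd_total hA a) b
  unfold sgn
  rcases zt_eq_one_or b (cen (fib q a)) with hz | hz <;> rw [hz] at h4 ⊢ <;> split_ifs with h3 <;> omega

/-- `σ_a = ±1`. [folklore] -/
theorem sgn_eq_one_or (a : Fin 5 → Bool) : sgn q ε a = 1 ∨ sgn q ε a = -1 := by
  unfold sgn
  split_ifs <;> simp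

/-- **(S3) Second moments**: `#{y ∈ A_a : y_j = y_k = 1} ≡ c_j c_k (mod 2)` for `j ≠ k`, where
`c = c(A_a)`; from the four residues at `b ∈ {0, e_j, e_k, e_j ⊕ e_k}`. [folklore] -/
theorem second_moment (hε : ∀ y, Odd (ε y)) (hA : ∀ a b, fs q ε a b % 8 = 3 ∨ fs q ε a b % 8 = 5)
    (a : Fin 5 → Bool) (j k : Fin 9) :
    ((#{y ∈ fib q a | y j = true ∧ y k = true} : ℕ) : ZMod 2) =
      if (cen (fib q a) j = true ∧ cen (fib q a) k = true) then 1 else 0 := by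
  set N : ℤ := ∑ y ∈ fib q a with (y j = true ∧ y k = true), ε y with hN
  have hcast : ((#{y ∈ fib q a | y j = true ∧ y k = true} : ℕ) : ZMod 2) = ((N : ℤ) : ZMod 2) := by
    rw [hN, intCast_sum_odd _ ε hε]
  have hid : 4 * N = fs q ε a (fun _ => false) - fs q ε a (unitVec j) - fs q ε a (unitVec k)
      + fs q ε a (fun i => xor (unitVec j i) (unitVec k i)) := by
    rw [hN, Finset.sum_filter]
    unfold fs
    rw [Finset.mul_sum, ← Finset.sum_sub_distrib, ← Finset.sum_sub_distrib, ← Finset.sum_add_distrib]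
    refine Finset.sum_congr rfl fun y _ => ?_
    rw [zt_xor, zt_zero, zt_unitVec, zt_unitVec,
      show ε y * 1 - ε y * (if y j = true then (-1 : ℤ) else 1) - ε y * (if y k = true then (-1 : ℤ) else 1) +
          ε y * ((if y j = true then (-1 : ℤ) else 1) * (if y k = true then (-1 : ℤ) else 1)) =
        ε y * ((1 - (if y j = true then (-1 : ℤ) else 1)) * (1 - (if y k = true then (-1 : ℤ) else 1))) by ring,
      ind_mul_ind]
    split_ifs <;> ring
  have e0 := fs_sub_dvd_eight hε hA a (fun _ => false)
  have ej := fs_sub_dvd_eight hε hA a (unitVec j)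
  have ek := fs_sub_dvd_eight hε hA a (unitVec k)
  have ejk := fs_sub_dvd_eight hε hA a (fun i => xor (unitVec j i) (unitVec k i))
  rw [zt_zero] at e0
  rw [zt_unitVec] at ej ek
  rw [zt_xor, zt_unitVec, zt_unitVec] at ejk
  have h2 : (2 : ℤ) ∣ (if (cen (fib q a) j = true ∧ cen (fib q a) k = true) then 1 else 0) - N := by
    rcases sgn_eq_one_or (q := q) (ε := ε) a with hs | hs <;> rw [hs] at e0 ej ek ejk <;>
      cases hcj : cen (fib q a) j <;> cases hck : cen (fib q a) k <;>
        simp only [hcj, hck, Bool.false_eq_true, and_false, and_self, and_true,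
          ↓reduceIte] at ej ek ejk ⊢ <;> omega
  rw [hcast, (ZMod.intCast_eq_intCast_iff_dvd_sub _ _ 2).mpr (by exact_mod_cast h2)]
  push_cast
  rfl

/-- **The fibres satisfy the moment condition** with respect to their own centroids. [folklore] -/
theorem momCond_fib (hε : ∀ y, Odd (ε y)) (hA : ∀ a b, fs q ε a b % 8 = 3 ∨ fs q ε a b % 8 = 5)
    (a : Fin 5 → Bool) (S : Finset (Fin 9)) (hS : #S ≤ 2) :
    ((#{y ∈ fib q a | ∀ i ∈ S, y i} : ℕ) : ZMod 2) = if (∀ i ∈ S, cen (fib q a) i) then 1 else 0 := by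
  obtain h0 | h1 | h2 : #S = 0 ∨ #S = 1 ∨ #S = 2 := by omega
  · rw [Finset.card_eq_zero] at h0
    subst h0
    simp only [Finset.notMem_empty, IsEmpty.forall_iff, implies_true, ↓reduceIte]
    rw [Finset.filter_true_of_mem (fun _ _ => trivial)]
    exact natCast_card_fib hε hA a
  · obtain ⟨j, rfl⟩ := Finset.card_eq_one.mp h1
    simp only [Finset.mem_singleton, forall_eq]
    unfold cen coordCount
    by_cases ho : Odd #{y ∈ fib q a | y j = true}
    · rw [if_pos (by simpa using ho)]
      exact (ZMod.natCast_eq_one_iff_odd).mpr ho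
    · rw [if_neg (by simpa using ho)]
      exact (ZMod.natCast_eq_zero_iff_even).mpr (Nat.not_odd_iff_even.mp ho)
  · obtain ⟨j, k, -, rfl⟩ := Finset.card_eq_two.mp h2
    simp only [Finset.mem_insert, Finset.mem_singleton, forall_eq_or_imp, forall_eq]
    exact second_moment hε hA a j k

/-- **(S4) The centroid lies in its fibre**: `φ(c(A_a)) = a` (apply the counting lemma to `r = qᵢ`,
which is constant on `A_a` of odd size). [folklore] -/
theorem cen_mem_fib (hq : ∀ i, IsDegLeFun 2 (q i)) (hε : ∀ y, Odd (ε y))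
    (hA : ∀ a b, fs q ε a b % 8 = 3 ∨ fs q ε a b % 8 = 5) (a : Fin 5 → Bool) : cen (fib q a) ∈ fib q a := by
  rw [mem_fib]
  intro i
  have h := natCast_card_filter_quadratic (momCond_fib hε hA a) (hq i)
  cases hai : a i
  · rw [Finset.filter_false_of_mem (fun y hy => by rw [(mem_fib.mp hy) i, hai]; decide),
      Finset.card_empty, Nat.cast_zero] at h
    cases hqc : q i (cen (fib q a))
    · rfl
    · rw [hqc] at h
      exact absurd h (by decide)
  · rw [Finset.filter_true_of_mem (fun y hy => by rw [(mem_fib.mp hy) i, hai]),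
      natCast_card_fib hε hA a] at h
    cases hqc : q i (cen (fib q a))
    · rw [hqc] at h
      exact absurd h (by decide)
    · rfl

/-- Distinct fibres have distinct centroids. [folklore] -/
theorem cen_injective (hq : ∀ i, IsDegLeFun 2 (q i)) (hε : ∀ y, Odd (ε y))
    (hA : ∀ a b, fs q ε a b % 8 = 3 ∨ fs q ε a b % 8 = 5)
    {a a' : Fin 5 → Bool} (h : cen (fib q a) = cen (fib q a')) : a = a' := by
  funext i
  rw [← (mem_fib.mp (cen_mem_fib hq hε hA a)) i, ← (mem_fib.mp (cen_mem_fib hq hε hA a')) i, h]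

/-! ### (S5) Gluing four fibres: the `2`-flat `a₂ = a₃ = a₄ = 0` -/

/-- The four values `(u, v, 0, 0, 0) ∈ 𝔽₂⁵`. [folklore] -/
def av (u v : Bool) : Fin 5 → Bool := fun i => if i = 0 then u else if i = 1 then v else false

/-- `w = (u,v,0,0,0)` coordinatewise. [folklore] -/
theorem forall_eq_av_iff (w : Fin 5 → Bool) (u v : Bool) :
    (∀ i, w i = av u v i) ↔ (w 0 = u ∧ w 1 = v ∧ w 2 = false ∧ w 3 = false ∧ w 4 = false) := by
  constructor
  · intro h
    refine ⟨by simpa [av] using h 0, by simpa [av] using h 1, by simpa [av] using h 2,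
      by simpa [av] using h 3, by simpa [av] using h 4⟩
  · rintro ⟨h0, h1, h2, h3, h4⟩ i
    fin_cases i <;> simp +decide [av, h0, h1, h2, h3, h4]

/-- `(u,v) ↦ (u,v,0,0,0)` is injective. [folklore] -/
theorem av_injective {u v u' v' : Bool} (h : av u v = av u' v') : u = u' ∧ v = v' := by
  have h0 := congr_fun h 0
  have h1 := congr_fun h 1
  simp +decide [av] at h0 h1
  exact ⟨h0, h1⟩

/-- **Gluing**: for a quadratic `r`, the Boolean function `y ↦ [φ(y) ∈ P] · r(y)` on `9` variables has
degree `≤ 2+2+2+2 = 8 < 9`, hence even weight; its weight is the sum over the four fibres above the flat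
`P = {a : a₂=a₃=a₄=0}`, each `≡ r(c(A_a)) (mod 2)`. So `Σ_{a ∈ P} r(c(A_a))` is even. [folklore] -/
theorem glue_even (hq : ∀ i, IsDegLeFun 2 (q i)) (hε : ∀ y, Odd (ε y))
    (hA : ∀ a b, fs q ε a b % 8 = 3 ∨ fs q ε a b % 8 = 5)
    {r : (Fin 9 → Bool) → Bool} (hr : IsDegLeFun 2 r) :
    (∑ uv : Bool × Bool, if r (cen (fib q (av uv.1 uv.2))) then (1 : ZMod 2) else 0) = 0 := by
  -- the glued function and its even weight
  set G : (Fin 9 → Bool) → Bool := fun y => ((!q 2 y && !q 3 y) && !q 4 y) && r y with hG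
  have hGdeg : IsDegLeFun 8 G :=
    isDegLeFun_and (isDegLeFun_and (isDegLeFun_and (isDegLeFun_not (hq 2)) (isDegLeFun_not (hq 3)))
      (isDegLeFun_not (hq 4))) hr
  have hGeven := natCast_card_eq_zero_of_isDegLeFun hGdeg (by norm_num)
  -- partition of the support of `G` by the values `(q₀ y, q₁ y)`
  have hpart : #{y : Fin 9 → Bool | G y} =
      ∑ uv : Bool × Bool, #{y ∈ fib q (av uv.1 uv.2) | r y} := by
    rw [Finset.card_eq_sum_card_fiberwise (f := fun y => (q 0 y, q 1 y)) (t := Finset.univ)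
      (fun _ _ => Finset.mem_coe.mpr (Finset.mem_univ _))]
    refine Finset.sum_congr rfl fun uv _ => congr_arg Finset.card ?_
    obtain ⟨u, v⟩ := uv
    ext y
    simp only [Finset.mem_filter, Finset.mem_univ, true_and, mem_fib, forall_eq_av_iff, hG,
      Bool.and_eq_true, Bool.not_eq_true', Prod.mk.injEq]
    tauto
  rw [hpart] at hGeven
  push_cast at hGeven
  exact (Finset.sum_congr rfl fun uv _ =>
    natCast_card_filter_quadratic (momCond_fib hε hA (av uv.1 uv.2)) hr).symm.trans hGeven

/-! ### The theorem -/

/-- **THEOREM MM59 (core form).** For NO quadratic map `φ = (q₀,…,q₄) : 𝔽₂⁹ → 𝔽₂⁵` and NO odd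
integer weights `ε : 𝔽₂⁹ → 2ℤ+1` (in particular no signs `ε = (-1)^h`, `h` arbitrary) are the signed fibre
sums `f_a(b) = Σ_{φ(y)=a} ε_y (-1)^{b·y}` all `≡ ±3 (mod 8)`. [folklore] -/
theorem no_residuePM3 (hq : ∀ i, IsDegLeFun 2 (q i)) (hε : ∀ y, Odd (ε y))
    (hA : ∀ a b, fs q ε a b % 8 = 3 ∨ fs q ε a b % 8 = 5) :
    False := by
  -- the four centroids above the flat `a₂ = a₃ = a₄ = 0` are distinct
  have hdist : ∀ {u v u' v' : Bool}, (u, v) ≠ (u', v') →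
      cen (fib q (av u v)) ≠ cen (fib q (av u' v')) := by
    intro u v u' v' hne h
    obtain ⟨rfl, rfl⟩ := av_injective (cen_injective hq hε hA h)
    exact hne rfl
  refine four_points (p₀ := cen (fib q (av false false))) (p₁ := cen (fib q (av false true)))
    (p₂ := cen (fib q (av true false))) (p₃ := cen (fib q (av true true)))
    (hdist (by decide)) (hdist (by decide)) (hdist (by decide)) (fun j => ?_) (fun j k hjk => ?_)
  · have h := glue_even hq hε hA (isDegLeFun_apply j (le_of_lt one_lt_two))
    exact (bool_sum_four (fun uv => cen (fib q (av uv.1 uv.2)) j)).mp h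
  · have h := glue_even hq hε hA
      (isDegLeFun_and (isDegLeFun_apply j le_rfl) (isDegLeFun_apply k le_rfl) : IsDegLeFun (1 + 1) _)
    exact (bool_sum_four (fun uv => cen (fib q (av uv.1 uv.2)) j && cen (fib q (av uv.1 uv.2)) k)).mp h

end Fibration

/-! ### Corollary at `n = 14 = 5 + 9`: the Walsh spectrum of a Maiorana–McFarland sign form -/

section Walsh

open Literature.Computability.QuantumComplexity.DerivativeWalsh (W)
open Summit.QuantumAdvantage.QuantumAdvantage.Theorems.CubicForrelation.NearExactIsExact (mw_sum_linear_block)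

/-- The odd weights `ε = (-1)^h`. [folklore] -/
def signWeight (h : (Fin 9 → Bool) → Bool) : (Fin 9 → Bool) → ℤ := fun y => if h y then -1 else 1

/-- `(-1)^h` is odd. [folklore] -/
theorem signWeight_odd (h : (Fin 9 → Bool) → Bool) (y : Fin 9 → Bool) : Odd (signWeight h y) := by
  unfold signWeight
  split_ifs <;> decide

/-- `(-1)^h` read in `ℝ` is `signOf h`. [folklore] -/
theorem cast_signWeight (h : (Fin 9 → Bool) → Bool) (y : Fin 9 → Bool) :
    (signWeight h y : ℝ) = signOf (h y) := by
  unfold signWeight signOf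
  split_ifs <;> simp

/-- **Walsh spectrum of a Maiorana–McFarland sign form over `φ`.** If
`(-1)^{g(x ‖ y)} = (-1)^{x·φ(y)} (-1)^{h(y)}` (`x ∈ 𝔽₂⁵`, `y ∈ 𝔽₂⁹`; i.e. `g(x,y) = x·φ(y) ⊕ h(y)`), then
`W_g(a ‖ b) = 2⁵ · f_a(b)` with `f_a(b) = Σ_{φ(y)=a} (-1)^{h(y)} (-1)^{b·y}` (sum over the linear block
first: `mw_sum_linear_block`). [folklore] -/
theorem W_signForm (q : Fin 5 → (Fin 9 → Bool) → Bool) (h : (Fin 9 → Bool) → Bool)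
    (g : (Fin (5 + 9) → Bool) → Bool)
    (hg : ∀ x y, signOf (g (Fin.append x y)) = twist x (fun i => q i y) * signOf (h y))
    (a : Fin 5 → Bool) (b : Fin 9 → Bool) :
    W (fun w => signOf (g w)) (Fin.append a b) = (2 : ℝ) ^ 5 * (fs q (signWeight h) a b : ℝ) := by
  unfold W
  rw [sum_append, Finset.sum_comm]
  have e : ∀ y : Fin 9 → Bool, ∀ x : Fin 5 → Bool,
      signOf (g (Fin.append x y)) * twist (Fin.append x y) (Fin.append a b) =
        signOf (h y) * twist y b * (twist (fun i => q i y) x * twist x a) := by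
    intro y x
    rw [twist_append, hg, twist_comm x (fun i => q i y)]
    ring
  rw [Finset.sum_congr rfl fun y _ => by
    rw [Finset.sum_congr rfl fun x _ => e y x, ← Finset.mul_sum, mw_sum_linear_block]]
  unfold fs fib
  push_cast
  rw [Finset.sum_filter, Finset.mul_sum]
  refine Finset.sum_congr rfl fun y _ => ?_
  by_cases hy : ∀ i, q i y = a i
  · rw [if_pos hy, if_pos (funext fun i => (hy i).symm), cast_zt, cast_signWeight, twist_comm b y]
    ring
  · rw [if_neg hy, if_neg (fun h' => hy fun i => (congr_fun h' i).symm)]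
    ring

/-- **THEOREM MM59 (route form, `n = 14`).** No Boolean function `g` on `5 + 9` bits of
Maiorana–McFarland type over a QUADRATIC map `φ = (q₀,…,q₄) : 𝔽₂⁹ → 𝔽₂⁵` — `g(x,y) = x·φ(y) ⊕ h(y)`, `h`
ARBITRARY (for cubic `g`: `h` any cubic), equivalently: `g` is affine on every coset of the `5`-space
`{(x,0)}` with quadratic "slope map" — has a Walsh spectrum `W_g = 2⁵ u` with all `u ≡ ±3 (mod 8)`.
This is exactly case A (`E = ∅`, near-extremal value `Φ = 31/32`) of the open `n = 14` window question for
the class `MM(5,9) ⊋ MM(7,7)`; no degree hypothesis on `g` is needed. [folklore] -/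
theorem no_caseA_signForm (q : Fin 5 → (Fin 9 → Bool) → Bool) (hq : ∀ i, IsDegLeFun 2 (q i))
    (h : (Fin 9 → Bool) → Bool) (g : (Fin (5 + 9) → Bool) → Bool)
    (hg : ∀ x y, signOf (g (Fin.append x y)) = twist x (fun i => q i y) * signOf (h y))
    (u : (Fin (5 + 9) → Bool) → ℤ) (hu : ∀ z, W (fun w => signOf (g w)) z = (2 : ℝ) ^ 5 * (u z : ℝ))
    (hA : ∀ z, u z % 8 = 3 ∨ u z % 8 = 5) : False := by
  refine no_residuePM3 (q := q) (ε := signWeight h) hq (signWeight_odd h) fun a b => ?_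
  have e : u (Fin.append a b) = fs q (signWeight h) a b := by
    have := hu (Fin.append a b)
    rw [W_signForm q h g hg] at this
    exact_mod_cast (mul_left_cancel₀ (by positivity) this).symm
  rw [← e]
  exact hA _

/-- The same with case A written through the base-2 digits of `u` as in the `n = 14` digit tables
(`u` odd and digit one `≠` digit two `⇔ u ≡ ±3 (mod 8)`). [folklore] -/
theorem no_caseA_signForm_digits (q : Fin 5 → (Fin 9 → Bool) → Bool) (hq : ∀ i, IsDegLeFun 2 (q i))
    (h : (Fin 9 → Bool) → Bool) (g : (Fin (5 + 9) → Bool) → Bool)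
    (hg : ∀ x y, signOf (g (Fin.append x y)) = twist x (fun i => q i y) * signOf (h y))
    (u : (Fin (5 + 9) → Bool) → ℤ) (hu : ∀ z, W (fun w => signOf (g w)) z = (2 : ℝ) ^ 5 * (u z : ℝ))
    (hodd : ∀ z, Odd (u z)) (hA : ∀ z, ¬ (Odd (u z / 2) ↔ Odd (u z / 2 / 2))) : False := by
  refine no_caseA_signForm q hq h g hg u hu fun z => ?_
  have h1 := hodd z
  have h2 := hA z
  rw [Int.odd_iff] at h1
  rw [Int.odd_iff, Int.odd_iff] at h2
  omega

end Walsh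

end Summit.QuantumAdvantage.QuantumAdvantage.Theorems.NearExactIsExact.Negative.MM59
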